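import Summits.HubbardSuperconductivity.HubbardSuperconductivity.Theorems.AnisotropyChordTransferFibre3Saddle
import Summits.HubbardSuperconductivity.HubbardSuperconductivity.Theorems.AnisotropyChordTransferFibre3DirichletResolvent

/-!
# Route `AnisotropyChord` / H0 rotor rung: THE MASTER INEQUALITY (MI) of the GM₃ certificate, proved

Memo ROTOR-THEORY-20 §284(c)/§290(b) and ROTOR-THEORY-21 §301 STEP 2 (theory seat `hubbard-h0-rotor-theory-1`): for `L ≥ 4`,
`0 < Δ`, `0 ≤ ε₁ + T`, `T < 2ε₁`, a shell-coercivity constant `ĝ > 0` at `T`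
(`ĝ Σ_S |y|²/(ΔW) ≤ Re⟨y, Q̃(T) y⟩` for all `y` — LEMMA L2/κ₀ in `Qtilde` language, cf. `L2Quant`), and every symmetric `Ψ`
vanishing on the hard core with `⟨v,Ψ⟩ = 3V²`:

  `Re⟨Ψ,(H − E)Ψ⟩ − (1 + κ_E Δ/ĝ)·Re⟨R′, G_T R′⟩ ≤ 3V²(Φ(T) − T)`,  `E = ε₁ + T`, `κ_E = 3ε₁/(2ε₁ − T)`, `R′ = 1_{Dᶜ}(H − E)Ψ`

(**`master_inequality`**), and the homogeneous form for any symmetric `Ψ` vanishing on `D` with `⟨v,Ψ⟩ ≠ 0`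
(**`master_inequality_hom`**: the same left side `≤ |⟨v,Ψ⟩|²/(3V²)·(Φ(T) − T)`).
Ingredients: the Krein–JF identity (`kreinJFIdentity_holds`), the saddle residual of `−(Krein charge)` is `(G_T R′)|_{D⊕S}`
(`Nmat_neg_kreinCharge_sub_vpole`), the abstract saddle bound (`Saddle.saddle_lower_bound`), the Dirichlet resolvent and the
ladder bound (`…Fibre3DirichletResolvent`), `G^D ≤ G`.
Prover seat `hubbard-h0-rotor-p1` g22; helper for stmt-HubbardSuperconductivity-19089 (`--supports`).
-/

set_option linter.dupNamespace false
set_option autoImplicit false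

noncomputable section

open scoped BigOperators
open Complex Matrix

namespace Summit.HubbardSuperconductivity.HubbardSuperconductivity.Theorems.AnisotropyChord.Transfer.Fibre3

variable (L : ℕ) [NeZero L]

/-! ## The saddle residual of the Krein charge -/

/-- **`𝒩(T)(−q) − v = (G_T R′)|_{D⊕S}`** for the Krein charge `q` of a symmetric `Ψ` vanishing on `D` with `⟨v,Ψ⟩ = 3V²`
(`Δ ≠ 0`, `T < 2ε₁`, `L ≥ 4`; memo 20 §282(a), last clause). [folklore] -/
theorem Nmat_neg_kreinCharge_sub_vpole (hL : 4 ≤ L) {Δ : ℝ} (hΔ : Δ ≠ 0) {T : ℝ} (hT : T < 2 * eps1 L)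
    (Ψ : Cfg L → ℂ) (hsym : IsSymm L (K1 L) Ψ) (hD : ∀ c, InD L c = true → Ψ c = 0)
    (hv : ip L (vfun L) Ψ = 3 * ((L : ℂ) ^ 2) ^ 2) :
    Nmat L T Δ *ᵥ (-(kreinCharge L T Δ Ψ)) - vpole L = fun i => Gapply L T (residual L T Δ Ψ) (cfgOf L i) := by
  classical
  have hL2 : 2 ≤ L := by omega
  have hV : (3 * ((L : ℂ) ^ 2) ^ 2) ≠ 0 := by
    have : (L : ℂ) ≠ 0 := by exact_mod_cast (NeZero.ne L)
    exact mul_ne_zero (by norm_num) (pow_ne_zero _ (pow_ne_zero _ this))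
  set E : ℂ := ((eps1 L + T : ℝ) : ℂ) with hE
  set ρ : Cfg L → ℂ := fun c => H0apply L (K1 L) Ψ c - E * Ψ c with hρ
  set qh : Cfg L → ℂ := fun c => if InD L c = true then ρ c else (Δ : ℂ) * (Wcount L c : ℂ) * Ψ c with hqh
  set R : Cfg L → ℂ := residual L T Δ Ψ with hR
  set q : DS L → ℂ := kreinCharge L T Δ Ψ with hq
  have hR_eq : ∀ c, R c = if InD L c = true then 0 else ρ c - (Δ : ℂ) * (Wcount L c : ℂ) * Ψ c := by
    intro c; simp only [hR, residual, Happly, hρ]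
    split_ifs <;> ring
  have hdec : ∀ c, ρ c = R c + qh c := by
    intro c; rw [hR_eq]; simp only [hqh]
    split_ifs <;> ring
  have hq_eq : ∀ j : DS L, q j = qh (cfgOf L j) := by
    rintro (d | s)
    · have h1 : qh d.1 = ρ d.1 := by simp only [hqh]; rw [if_pos d.2]
      show kreinCharge L T Δ Ψ (Sum.inl d) = qh d.1
      rw [h1]; rfl
    · have h1 : qh s.1 = (Δ : ℂ) * (Wcount L s.1 : ℂ) * Ψ s.1 := by
        simp only [hqh]; rw [if_neg (by simp [InD_false_of_InS L s.2])]
      show kreinCharge L T Δ Ψ (Sum.inr s) = qh s.1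
      rw [h1]; rfl
  have hqh0 : ∀ c, InD L c = false → InS L c = false → qh c = 0 := by
    intro c hDc hSc
    simp only [hqh, hDc, Bool.false_eq_true, if_false, Wcount_eq_zero L hDc hSc, Nat.cast_zero, mul_zero, zero_mul]
  -- Gρ = Ψ − v and G qh = Ψ − v − G R
  have hGρ : ∀ c, Gapply L T ρ c = Ψ c - vfun L c := by
    intro c
    have e := Gapply_H0E L hL hT Ψ c
    rw [PiPole_symm L hL2 hsym, hv, div_self hV, one_mul] at e
    exact e
  have hGqh : ∀ c, Gapply L T qh c = Ψ c - vfun L c - Gapply L T R c := by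
    intro c
    have e1 : Gapply L T ρ c = Gapply L T R c + Gapply L T qh c := by
      rw [← Gapply_add]; unfold Gapply; refine Finset.sum_congr rfl fun c' _ => ?_; rw [hdec c']
    rw [hGρ] at e1
    linear_combination -e1
  -- the rows of 𝒩 q
  funext i
  rw [Pi.sub_apply, Matrix.mulVec_neg, Pi.neg_apply]
  rcases i with d | s
  · rw [Nmat_mulVec_inl]
    simp_rw [hq_eq]
    rw [sum_Gentry_DS L T qh hqh0, hGqh, hD d.1 d.2]
    simp only [vpole, cfgOf, vfun]
    ring
  · rw [Nmat_mulVec_inr]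
    simp_rw [hq_eq]
    rw [sum_Gentry_DS L T qh hqh0, hGqh]
    have hSD : InD L s.1 = false := InD_false_of_InS L s.2
    have h1 : qh (cfgOf L (Sum.inr s)) = (Δ : ℂ) * (Wcount L s.1 : ℂ) * Ψ s.1 := by
      simp only [cfgOf, hqh, hSD, Bool.false_eq_true, if_false]
    rw [h1]
    have hW : (Wcount L s.1 : ℂ) ≠ 0 := by
      have := Wcount_pos_of_InS L s.2; exact_mod_cast (by omega : Wcount L s.1 ≠ 0)
    have hΔ' : (Δ : ℂ) ≠ 0 := by exact_mod_cast hΔ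
    simp only [vpole, cfgOf, vfun]
    push_cast
    field_simp
    ring

/-! ## Invertibility of `𝒩(T)` from shell coercivity -/

/-- shell coercivity ⇒ `Q̃(T)` injective ⇒ `det 𝒩(T) ≠ 0` (`T < 2ε₁`, `L ≥ 4`, `0 < Δ`). [folklore] -/
theorem det_Nmat_ne_zero_of_coercive (hL : 4 ≤ L) {Δ : ℝ} (hΔ : 0 < Δ) {T : ℝ} (hT : T < 2 * eps1 L)
    (g : ℝ) (hg : 0 < g)
    (hcoer : ∀ y : Ssub L → ℂ, g * ∑ s, ‖y s‖ ^ 2 / (Δ * (Wcount L s.1 : ℝ)) ≤ (star y ⬝ᵥ Qtilde L T Δ *ᵥ y).re) :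
    (Nmat L T Δ).det ≠ 0 := by
  rw [det_Nmat_ne_zero_iff L hL hT Δ]
  intro hdet
  obtain ⟨y, hy, hQy⟩ := Matrix.exists_mulVec_eq_zero_iff.mpr hdet
  have h0 : (star y ⬝ᵥ Qtilde L T Δ *ᵥ y).re = 0 := by rw [hQy, dotProduct_zero, Complex.zero_re]
  have hpos : 0 < ∑ s, ‖y s‖ ^ 2 / (Δ * (Wcount L s.1 : ℝ)) := by
    obtain ⟨s, hs'⟩ := Function.ne_iff.mp hy
    have hs : y s ≠ 0 := by simpa using hs'
    apply Finset.sum_pos'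
    · intro s' _
      have := Wcount_pos_of_InS L s'.2
      positivity
    · refine ⟨s, Finset.mem_univ _, ?_⟩
      have hW := Wcount_pos_of_InS L s.2
      have : (0 : ℝ) < Wcount L s.1 := by exact_mod_cast hW
      have hn : 0 < ‖y s‖ := norm_pos_iff.mpr hs
      positivity
  have := hcoer y
  rw [h0] at this
  nlinarith

/-! ## The master inequality -/

/-- **THE MASTER INEQUALITY (MI)** (memo 20 §284(c) with `κ_E` of §290(b); memo 21 §301 STEP 2):
`Re⟨Ψ,(H−E)Ψ⟩ − (1 + κ_E Δ/ĝ) Re⟨R′,G_T R′⟩ ≤ 3V²(Φ(T) − T)` for symmetric `Ψ` vanishing on `D` with `⟨v,Ψ⟩ = 3V²`,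
`0 < Δ`, `0 ≤ ε₁ + T`, `T < 2ε₁`, `L ≥ 4`, and shell coercivity constant `ĝ > 0` at `T`. [folklore] -/
theorem master_inequality (hL : 4 ≤ L) {Δ : ℝ} (hΔ : 0 < Δ) {T : ℝ} (hE : 0 ≤ eps1 L + T) (hT : T < 2 * eps1 L)
    (g : ℝ) (hg : 0 < g)
    (hcoer : ∀ y : Ssub L → ℂ, g * ∑ s, ‖y s‖ ^ 2 / (Δ * (Wcount L s.1 : ℝ)) ≤ (star y ⬝ᵥ Qtilde L T Δ *ᵥ y).re)
    (Ψ : Cfg L → ℂ) (hsym : IsSymm L (K1 L) Ψ) (hD : ∀ c, InD L c = true → Ψ c = 0)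
    (hv : ip L (vfun L) Ψ = 3 * ((L : ℂ) ^ 2) ^ 2) :
    (ip L Ψ (fun c => Happly L (K1 L) Δ Ψ c - ((eps1 L + T : ℝ) : ℂ) * Ψ c)).re
        - (1 + (3 * eps1 L / (2 * eps1 L - T)) * Δ / g) * (Gform L T (residual L T Δ Ψ) (residual L T Δ Ψ)).re
      ≤ 3 * ((L : ℝ) ^ 2) ^ 2 * (Phi L T Δ - T) := by
  classical
  set R := residual L T Δ Ψ with hR
  set q := kreinCharge L T Δ Ψ with hq
  -- hypotheses of the abstract saddle bound
  have hP : (Pmat L T)ᴴ = Pmat L T := (Pmat_isHermitian L T).eq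
  have hB := BHmat_conjTranspose L T
  have hNH : (Matrix.fromBlocks (Pmat L T) (BHmat L T) (Bmat L T) (Cmat L T Δ))ᴴ
      = Matrix.fromBlocks (Pmat L T) (BHmat L T) (Bmat L T) (Cmat L T Δ) := by
    rw [← Nmat_eq_fromBlocks]; exact Nmat_conjTranspose L T Δ
  have hdetP : IsUnit (Pmat L T).det := isUnit_iff_ne_zero.mpr (det_P_ne_zero L hL hT)
  have hdetN : IsUnit (Matrix.fromBlocks (Pmat L T) (BHmat L T) (Bmat L T) (Cmat L T Δ)).det := by
    rw [← Nmat_eq_fromBlocks]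
    exact isUnit_iff_ne_zero.mpr (det_Nmat_ne_zero_of_coercive L hL hΔ hT g hg hcoer)
  have hPnn : ∀ w : Dsub L → ℂ, 0 ≤ (star w ⬝ᵥ Pmat L T *ᵥ w).re := fun w => re_P_nonneg L hL hT w
  have hω : ∀ s : Ssub L, 0 < Δ * (Wcount L s.1 : ℝ) := by
    intro s
    have := Wcount_pos_of_InS L s.2
    have : (0 : ℝ) < Wcount L s.1 := by exact_mod_cast this
    positivity
  have hcoer' : ∀ y : Ssub L → ℂ, g * ∑ s, ‖y s‖ ^ 2 / (Δ * (Wcount L s.1 : ℝ))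
      ≤ (star y ⬝ᵥ (-(Cmat L T Δ - Bmat L T * (Pmat L T)⁻¹ * BHmat L T)) *ᵥ y).re := fun y => hcoer y
  -- the saddle residual and its Schur reduction
  have he : Matrix.fromBlocks (Pmat L T) (BHmat L T) (Bmat L T) (Cmat L T Δ) *ᵥ (-q) - vpole L
      = fun i => Gapply L T R (cfgOf L i) := by
    rw [← Nmat_eq_fromBlocks]; exact Nmat_neg_kreinCharge_sub_vpole L hL hΔ.ne' hT Ψ hsym hD hv
  have het : ∀ s : Ssub L, GDapply L T R s.1
      = (fun i => Gapply L T R (cfgOf L i)) (Sum.inr s)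
        - (Bmat L T *ᵥ ((Pmat L T)⁻¹ *ᵥ fun d => (fun i => Gapply L T R (cfgOf L i)) (Sum.inl d))) s := by
    intro s; rw [GDapply_S_eq]; rfl
  have hsad := Saddle.saddle_lower_bound (Pmat L T) (BHmat L T) (Bmat L T) (Cmat L T Δ) hP hB hNH hdetP hdetN hPnn
    (fun s : Ssub L => Δ * (Wcount L s.1 : ℝ)) hω g hg hcoer' (vpole L) (-q) _ he (fun s => GDapply L T R s.1) het
  rw [← Nmat_eq_fromBlocks] at hsad
  -- the Krein–JF identity
  have hKJF := kreinJFIdentity_holds L hL Δ T hT Ψ hsym hD hv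
  have hS : saddleS L T Δ (-q) = 2 * (star (-q) ⬝ᵥ vpole L).re - (star (-q) ⬝ᵥ Nmat L T Δ *ᵥ (-q)).re := rfl
  -- the ladder term
  have hlad := ladder_bound L hL hT hE hΔ.le R
  have hGD := re_ip_GD_R_le L hL hT R
  have hκ : 0 ≤ 3 * eps1 L / (2 * eps1 L - T) := by
    have := eps1_pos L hL; apply div_nonneg <;> linarith
  have hlad' : (∑ s : Ssub L, (Δ * (Wcount L s.1 : ℝ)) * ‖GDapply L T R s.1‖ ^ 2) / g
      ≤ (3 * eps1 L / (2 * eps1 L - T)) * Δ / g * (Gform L T R R).re := by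
    rw [div_mul_eq_mul_div]
    apply div_le_div_of_nonneg_right _ hg.le
    calc ∑ s : Ssub L, (Δ * (Wcount L s.1 : ℝ)) * ‖GDapply L T R s.1‖ ^ 2
        ≤ Δ * (3 * eps1 L / (2 * eps1 L - T)) * (ip L (GDapply L T R) R).re := hlad
      _ ≤ Δ * (3 * eps1 L / (2 * eps1 L - T)) * (Gform L T R R).re :=
          mul_le_mul_of_nonneg_left hGD (mul_nonneg hΔ.le hκ)
      _ = (3 * eps1 L / (2 * eps1 L - T)) * Δ * (Gform L T R R).re := by ring
  -- Φ
  have hΦ : (star (vpole L) ⬝ᵥ (Nmat L T Δ)⁻¹ *ᵥ vpole L).re = 3 * ((L : ℝ) ^ 2) ^ 2 * Phi L T Δ := by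
    unfold Phi
    have hVpos : (0 : ℝ) < 3 * ((L : ℝ) ^ 2) ^ 2 := by
      have : (0 : ℝ) < L := by exact_mod_cast Nat.pos_of_ne_zero (NeZero.ne L)
      positivity
    field_simp
  rw [← hS, hKJF, hΦ, ← hR] at hsad
  linarith [hsad, hlad']

/-! ## The homogeneous form -/

omit [NeZero L] in
/-- residual of a scalar multiple. [folklore] -/
theorem residual_smul (T Δ : ℝ) (a : ℂ) (Ψ : Cfg L → ℂ) : residual L T Δ (a • Ψ) = a • residual L T Δ Ψ := by
  funext c
  simp only [residual, Pi.smul_apply, smul_eq_mul, Happly_smul]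
  split_ifs <;> ring

/-- the energy form of a scalar multiple. [folklore] -/
theorem re_energy_smul (Δ : ℝ) (E : ℂ) (a : ℂ) (Ψ : Cfg L → ℂ) :
    (ip L (a • Ψ) (fun c => Happly L (K1 L) Δ (a • Ψ) c - E * (a • Ψ) c)).re
      = ‖a‖ ^ 2 * (ip L Ψ (fun c => Happly L (K1 L) Δ Ψ c - E * Ψ c)).re := by
  have h : (fun c => Happly L (K1 L) Δ (a • Ψ) c - E * (a • Ψ) c) = a • (fun c => Happly L (K1 L) Δ Ψ c - E * Ψ c) := by
    funext c; simp only [Happly_smul, Pi.smul_apply, smul_eq_mul]; ring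
  rw [h, ip_smul_left, ip_smul_right, ← mul_assoc, Complex.conj_mul' a]
  rw [show ((‖a‖ : ℂ) ^ 2) = (((‖a‖ ^ 2 : ℝ)) : ℂ) by push_cast; ring, Complex.re_ofReal_mul]

/-- the `G`-form of a scalar multiple. [folklore] -/
theorem re_Gform_smul (T : ℝ) (a : ℂ) (A : Cfg L → ℂ) :
    (Gform L T (a • A) (a • A)).re = ‖a‖ ^ 2 * (Gform L T A A).re := by
  have h : Gapply L T (a • A) = a • Gapply L T A := by
    funext c; unfold Gapply; simp only [Pi.smul_apply, smul_eq_mul]; rw [Finset.mul_sum]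
    refine Finset.sum_congr rfl fun c' _ => ?_; ring
  rw [Gform_eq_ip, Gform_eq_ip, h, ip_smul_left, ip_smul_right, ← mul_assoc, Complex.conj_mul' a]
  rw [show ((‖a‖ : ℂ) ^ 2) = (((‖a‖ ^ 2 : ℝ)) : ℂ) by push_cast; ring, Complex.re_ofReal_mul]

/-- **THE MASTER INEQUALITY, homogeneous form:** for any symmetric `Ψ` vanishing on `D` with `⟨v,Ψ⟩ ≠ 0`,
`Re⟨Ψ,(H−E)Ψ⟩ − (1 + κ_EΔ/ĝ)·Re⟨R′,G_T R′⟩ ≤ (|⟨v,Ψ⟩|²/3V²)·(Φ(T) − T)` (apply `master_inequality` to `Ψ/β`,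
`β = ⟨v,Ψ⟩/3V²`, and multiply by `|β|²`). [folklore] -/
theorem master_inequality_hom (hL : 4 ≤ L) {Δ : ℝ} (hΔ : 0 < Δ) {T : ℝ} (hE : 0 ≤ eps1 L + T) (hT : T < 2 * eps1 L)
    (g : ℝ) (hg : 0 < g)
    (hcoer : ∀ y : Ssub L → ℂ, g * ∑ s, ‖y s‖ ^ 2 / (Δ * (Wcount L s.1 : ℝ)) ≤ (star y ⬝ᵥ Qtilde L T Δ *ᵥ y).re)
    (Ψ : Cfg L → ℂ) (hsym : IsSymm L (K1 L) Ψ) (hD : ∀ c, InD L c = true → Ψ c = 0)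
    (hβ : ip L (vfun L) Ψ ≠ 0) :
    (ip L Ψ (fun c => Happly L (K1 L) Δ Ψ c - ((eps1 L + T : ℝ) : ℂ) * Ψ c)).re
        - (1 + (3 * eps1 L / (2 * eps1 L - T)) * Δ / g) * (Gform L T (residual L T Δ Ψ) (residual L T Δ Ψ)).re
      ≤ ‖ip L (vfun L) Ψ‖ ^ 2 / (3 * ((L : ℝ) ^ 2) ^ 2) * (Phi L T Δ - T) := by
  have hVc : (3 * ((L : ℂ) ^ 2) ^ 2) ≠ 0 := by
    have : (L : ℂ) ≠ 0 := by exact_mod_cast (NeZero.ne L)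
    exact mul_ne_zero (by norm_num) (pow_ne_zero _ (pow_ne_zero _ this))
  have hVpos : (0 : ℝ) < 3 * ((L : ℝ) ^ 2) ^ 2 := by
    have : (0 : ℝ) < L := by exact_mod_cast Nat.pos_of_ne_zero (NeZero.ne L)
    positivity
  set βc : ℂ := ip L (vfun L) Ψ / (3 * ((L : ℂ) ^ 2) ^ 2) with hβc
  have hβc0 : βc ≠ 0 := div_ne_zero hβ hVc
  set Ψ' : Cfg L → ℂ := (1 / βc) • Ψ with hΨ'
  have hmem := symD_smul L (K1 L) (1 / βc) (show Ψ ∈ symD L (K1 L) from ⟨hsym, hD⟩)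
  have hsym' : IsSymm L (K1 L) Ψ' := hmem.1
  have hD' : ∀ c, InD L c = true → Ψ' c = 0 := hmem.2
  have hv' : ip L (vfun L) Ψ' = 3 * ((L : ℂ) ^ 2) ^ 2 := by
    rw [hΨ', ip_smul_right, hβc]; field_simp
  have hMI := master_inequality L hL hΔ hE hT g hg hcoer Ψ' hsym' hD' hv'
  rw [hΨ', re_energy_smul, residual_smul, re_Gform_smul] at hMI
  -- ‖1/βc‖² · X ≤ 3V²(Φ − T)  ⇒  X ≤ |⟨v,Ψ⟩|²/(3V²)·(Φ − T)
  have hn : ‖(1 / βc)‖ ^ 2 = 1 / ‖βc‖ ^ 2 := by rw [norm_div, norm_one, div_pow, one_pow]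
  have hβn : 0 < ‖βc‖ ^ 2 := by positivity
  have hβ2 : ‖βc‖ ^ 2 = ‖ip L (vfun L) Ψ‖ ^ 2 / (3 * ((L : ℝ) ^ 2) ^ 2) ^ 2 := by
    rw [hβc, norm_div, div_pow]
    congr 2
    rw [show (3 * ((L : ℂ) ^ 2) ^ 2) = (((3 * ((L : ℝ) ^ 2) ^ 2 : ℝ)) : ℂ) by push_cast; ring, Complex.norm_real,
      Real.norm_of_nonneg hVpos.le]
  rw [hn] at hMI
  have key : (ip L Ψ (fun c => Happly L (K1 L) Δ Ψ c - ((eps1 L + T : ℝ) : ℂ) * Ψ c)).re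
      - (1 + (3 * eps1 L / (2 * eps1 L - T)) * Δ / g) * (Gform L T (residual L T Δ Ψ) (residual L T Δ Ψ)).re
      ≤ ‖βc‖ ^ 2 * (3 * ((L : ℝ) ^ 2) ^ 2 * (Phi L T Δ - T)) := by
    have h2 := mul_le_mul_of_nonneg_left hMI hβn.le
    have hβn' : ‖βc‖ ^ 2 ≠ 0 := hβn.ne'
    have e : ‖βc‖ ^ 2 * (1 / ‖βc‖ ^ 2 * (ip L Ψ (fun c => Happly L (K1 L) Δ Ψ c - ((eps1 L + T : ℝ) : ℂ) * Ψ c)).re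
          - (1 + (3 * eps1 L / (2 * eps1 L - T)) * Δ / g)
            * (1 / ‖βc‖ ^ 2 * (Gform L T (residual L T Δ Ψ) (residual L T Δ Ψ)).re))
        = (ip L Ψ (fun c => Happly L (K1 L) Δ Ψ c - ((eps1 L + T : ℝ) : ℂ) * Ψ c)).re
          - (1 + (3 * eps1 L / (2 * eps1 L - T)) * Δ / g) * (Gform L T (residual L T Δ Ψ) (residual L T Δ Ψ)).re := by
      field_simp
    rw [e] at h2
    exact h2
  calc _ ≤ ‖βc‖ ^ 2 * (3 * ((L : ℝ) ^ 2) ^ 2 * (Phi L T Δ - T)) := key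
    _ = ‖ip L (vfun L) Ψ‖ ^ 2 / (3 * ((L : ℝ) ^ 2) ^ 2) * (Phi L T Δ - T) := by
        rw [hβ2]; field_simp

end Summit.HubbardSuperconductivity.HubbardSuperconductivity.Theorems.AnisotropyChord.Transfer.Fibre3

end
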